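import Summits.QuantumAdvantage.QuantumAdvantage.Theses.LinnikCubicClassGroups
import Summits.QuantumAdvantage.QuantumAdvantage.Theorems.LinnikCubicClassGroupsPureCubicClassGroupFBQPStubCubicFieldFacts

/-!
# Disproof of `PureCubicClassGroupFBQP` — findings

Crux `stmt-QuantumAdvantage-11544` of route `LinnikCubicClassGroups`:

  `PureCubicClassGroupFBQP : DegreeOnePrimesEscape → ∃ f ∈ FBQP, (∀ x, |f x| = 2|x|+8) ∧ ValueClause f`

where `ValueClause f` says `f x` is the list of the `2|x|+8` low bits of `h(K)` for every cubic
number field `K` containing a cube root of the non-cube `m = decodeNat x`.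

Standing adversary file (refuter, cdisprove mode).  Prose lives in docstrings; every `theorem` is
checked.  Summary of findings (details at the declarations):

* `not_crux_iff` — ANATOMY: a disproof is exactly a proof of `DegreeOnePrimesEscape` (crux #2 of the
  route, Thorner–Zaman + Stark) together with a proof that NO bounded-error quantum polynomial-time
  family outputs the class-number bits (`¬ Conclusion`).  The second conjunct is a quantum lower bound
  for a function computable in polynomial space; nothing of the kind is provable today, and under GRH
  the conclusion is a theorem in print (Hallgren 2005 / Biasse–Song 2016).  Hence the crux RESISTS
  every refutation that does not first prove crux #2 and then separate `FBQP` from `FPSPACE`-type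
  functions on this explicit instance.
* `crux_of_not_escape`, `crux_of_conclusion` — the two cheap ways the crux could become TRIVIAL:
  crux #2 refuted (then this crux is vacuously true and the ROUTE dies at item 11543, not here), or the
  conclusion proved outright (Hallgren without GRH — open).
* LOAD-BEARING ANALYSIS (`…Without…` / `not_…`): dropping the non-cube guard `∀ r, r³ ≠ m`, the
  cube-root clause `∃ α, α³ = m`, or the degree clause `finrank ℚ K = 3` makes the value clause
  INCONSISTENT (two admissible fields with different class numbers are forced to share `f x`), so the
  mutilated crux collapses to `¬ DegreeOnePrimesEscape` and would contradict the route's own crux #2.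
  The arithmetic inputs (e.g. `h(ℚ(∛2)) = 1` — Cohen GTM 138 Table B.3, `d = −108`, `A = X³ − 2`,
  `h = 1`; `h = 2` at `d = −283, −331` ibid.; `h(ℚ(∛7)) = 3`; some `ℚ(∛2, √−d)` with
  `h ≢ 1 (mod 2^10)`) are not available in Mathlib; they enter as explicit hypotheses
  (`TwoCubicClassNumbersMod` — backed by the printed table —, `TwoCbrtTwoFieldsMod` — unverified
  until the job reports) with a GRH-free PARI `bnfinit` + `bnfcertify` certification queued as
  compute job j004809 (Part C; the shared queue was saturated throughout cycle 1, > 6 h, no result).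
* Dropping `f ∈ FBQP` leaves a TRUE statement (`conclusionWithoutFBQP`, PROVED here, sorry-free):
  the value clause is consistent because all admissible `K` at a given `x` are `≅ ℚ[X]/(X³ − m)`
  (`nonempty_algEquiv_adjoinRoot`: Kummer irreducibility of `X³ − m` for a non-cube `m`, rational
  cube roots of naturals are naturals, injective `ℚ`-algebra map between 3-dimensional spaces) and the
  class number is an isomorphism invariant (`classNumber_eq_of_ringEquiv`, via Mathlib's
  `ClassGroup.extendedHom` along `e` and `e⁻¹`).  Hence the crux is EQUIVALENT to a pure complexity
  claim about ONE explicit function (`conclusion_iff_canonical`, `crux_of_canonicalF_mem`): put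
  `canonicalF` (class-number bits on admissible inputs, zeros elsewhere) into `FBQP`.  These positive
  lemmas are what a prover needs for the "for every admissible `K`" quantifier; they travel as item
  evidence.
* MECHANISM AUDIT (informal, kill criterion (a) of the route): where do the printed algorithms use
  GRH?  Childs–van Dam, Rev. Mod. Phys. 82 (2010), arXiv:0812.0380 p. 24: "Assuming the generalized
  Riemann hypothesis (GRH), there is a polynomial-time algorithm to find generators of Cl(K) [Thi95] …
  there is an efficient quantum algorithm for decomposing Cl(K), provided K has constant degree and
  assuming the GRH [Hal05]" — GRH enters at generator-finding; the coset-superposition representation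
  of ideal classes [Wat01b] and the (continuous) HSP post-processing are unconditional.  Hallgren 2005
  (doi:10.1145/1060590.1060660) and Biasse–Song 2016 (doi:10.1137/1.9781611974331.ch64) are paywalled
  here (acq-01945 / acq-01948 open); their abstracts put GRH on the class group statement only.  With a
  random large factor base: the S-unit/relation lattice of `T = O(log D)` degree-one primes of norm
  `≤ D^C` has rank `T + r` UNCONDITIONALLY (S-unit theorem), covolume `h·R·∏ log N(Pᵢ)` so
  `log covol = O(log D · log log D)` — polynomial precision; if the `Pᵢ` generate only a subgroup of
  index `j` the HSP silently returns `h/j`, which the bounded-error definition of `FBQP` tolerates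
  since generation holds w.p. `≥ 1 − 1/D`.  Remark for the prover: the informal `T = O(log |D_K|)`
  is right by the CHAIN argument (every proper subgroup lies in a maximal one, so each draw enlarges
  the generated subgroup w.p. `≥ δ`, at most `log₂ h` enlargements: `T = O((log h + log(1/ε))/δ)`),
  whereas the filed `RandomSamplesGenerate` (union bound over `#Sub(G) ≤ h^{log₂ h}` subgroups) only
  yields `T = O(log² h / δ)` — both polynomial.  Inadmissible inputs (cubes, `m = 0`) must be
  detected by the circuit family itself (integer cube root, in `P`) so that `f` has the fixed length
  and value zeros there.  No hidden GRH/heuristic step found; nothing here refutes the `∃ f` claim,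
  which a broken mechanism could not refute anyway.
* STRUCTURAL REMARK for the planner's foreseen split (`ContinuousHspFBQP → RelationLatticeOracle`):
  a pure cubic field `ℚ(∛m)` is a COMPLEX cubic field (one real place, one complex place), so its
  unit rank is `r = 1` and the continuous part of the hidden-subgroup problem is ONE-dimensional —
  the hidden lattice lives in `ℤ^T × ℝ`, exactly the shape of Hallgren's real-quadratic (Pell /
  principal-ideal, J. ACM 2007) machinery, with Voronoi's chain of relative minima (Buchmann–Williams
  infrastructure of complex cubic fields) in place of the continued-fraction cycle; the arbitrary-
  degree apparatus of EHKS14 / Biasse–Song (HSP in `ℝ^{O(n)}`) is not needed at `n = 3`.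
* Numerics (jobs j004809 / j004811, PARI, certified class groups; QUEUED, not yet run): escape
  ratios `#{P : N P = q ≤ x prime, [P] ∉ M}/π(x)` over all maximal subgroups `M` of `Cl(ℚ(∛m))`
  (`m ≤ 120`, `x ∈ {10⁴, 10⁵, 10⁶}`), and the number of random degree-one primes of norm `≤ |D|²`
  needed to generate `Cl` — they probe the hypothesis `DegreeOnePrimesEscape` at `n = 3` and the
  generation step; they cannot refute an `∃ C` statement.  Results attach to the item automatically.

CYCLE 2 (gen 2, 2026-08-16) additions — see the sections `Cycle 2: …` below:

* PADDED INPUTS: `decodeNat (replicate (L+1) false) = 2^(L+1)` (`decodeNat_replicate_false`), so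
  the value clause can be probed at inputs of any length with `m` a prescribed power of two
  (`cubeInput j ↦ (2^(j+1))³`, `nonCubeInput j ↦ 2·(2^(j+1))³`, `two_pow_not_cube`); with
  `2|x|+8` bits exceeding the class numbers involved, shared bit-strings force EQUAL class numbers
  (`classNumber_eq_of_bits_eq`).  Hence the load-bearing lemmas now hold under the weakest
  conceivable, MODULUS-FREE arithmetic inputs `TwoCubicClassNumbers` (two cubic fields with
  different class numbers) and `TwoCbrtTwoFields` (two fields `∋ ∛2` with different class numbers):
  `not_valueClauseWithout{NonCube,CubeRoot,Degree}_of_ne`, `not_conclusionWithout…'`,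
  `cruxWithout…_iff'`; the cycle-1 `…Mod` inputs imply the new ones (`…_of_mod`).
* HYPOTHESIS STRENGTH: the line consumes only the `n = 3` slice of `DegreeOnePrimesEscape`
  (landed `stub_generation`: `obtain ⟨C₃, hC₃⟩ := hEsc 3`), where the no-quadratic-subfield clause
  is automatic (`cubic_no_quadratic_subfield`, `cubicEscape_iff`); so the skeleton proves the
  STRONGER `PureCubicClassGroupFBQPOfCubicEscape := CubicEscape → Conclusion`
  (`crux_of_cruxOfCubicEscape`), and the degenerate slices `n = 0, 1, 2` of the hypothesis hold
  trivially (`degreeOnePrimesEscapeAt_zero/_one/_two`) — no junk there either.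

* ARITHMETIC INPUTS DISCHARGED (v4): `classNumber_eq_one_of_cbrt_two` (every cubic field `∋ ∛2`
  has `h = 1`: Minkowski bound `< 3` from the landed `|d_K| ≤ 108`, the prime of norm `2` is `(α)`)
  and `classNumber_ne_one_of_cbrt_seven` (every cubic field `∋ ∛7` has `h ≠ 1`: `ℤ[α]` is
  `7`-maximal by Eisenstein, the norm form `a³ + 7b³ + 49c³ − 21abc` makes integer norms cubes
  mod `7`, so the prime of norm `2` dividing `(α − 1)` is not principal) make `TwoCubicClassNumbers`
  a theorem (`twoCubicClassNumbers`): the non-cube guard and the cube-root clause are load-bearing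
  UNCONDITIONALLY (`not_conclusionWithoutNonCube_holds`, `not_conclusionWithoutCubeRoot_holds`,
  `cruxWithout{NonCube,CubeRoot}_iff_not_escape`), and the value clause gets a unit test:
  `f [false] = 1` in ten bits for every `f` with the value clause (`valueClause_at_false`,
  `canonicalF_false`).  Only the degree clause still rests on an input (`TwoCbrtTwoFields`: a field
  `∋ ∛2` with `h ≠ 1`, e.g. `ℚ(∛2, √−5)` — PARI job j013640).

Nothing here is a refutation.  WHY IT RESISTS, in one line: the statement is
`(deep but plausible density hypothesis) → (existence of a quantum algorithm)`, and existence-of-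
algorithm claims are only refutable by lower bounds we do not have; every side condition that could
have made the value clause self-contradictory (cubes, `m = 0`, missing cube root, wrong degree,
non-injective `decodeNat`, output length) was checked and holds up.
-/

set_option linter.dupNamespace false

noncomputable section

namespace Summit.QuantumAdvantage.QuantumAdvantage.Cruxes.PureCubicClassGroupFBQP.Disproof

open Summit.QuantumAdvantage.QuantumAdvantage.Theses.LinnikCubicClassGroups
open Literature.Computability.Cryptography (FBQP)
open Computability (decodeNat)

/-! ## The parts of the crux -/

/-- The bit list demanded of `f x`: the `2|x|+8` low bits of `h(K)`. -/
noncomputable def classNumberBits (x : List Bool) (K : Type) [Field K] [NumberField K] : List Bool :=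
  List.ofFn (fun i : Fin (2 * x.length + 8) => (NumberField.classNumber K).testBit i.val)

/-- The value clause of the crux for a candidate `f`. -/
def ValueClause (f : List Bool → List Bool) : Prop :=
  ∀ (x : List Bool) (K : Type) [Field K] [NumberField K], Module.finrank ℚ K = 3 →
    (∀ r : ℕ, r ^ 3 ≠ decodeNat x) → (∃ α : K, α ^ 3 = (decodeNat x : K)) →
    f x = classNumberBits x K

/-- The length clause. -/
def LengthClause (f : List Bool → List Bool) : Prop := ∀ x, (f x).length = 2 * x.length + 8

/-- The conclusion `B` of the crux (`crux = DegreeOnePrimesEscape → Conclusion`). -/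
def Conclusion : Prop := ∃ f : List Bool → List Bool, f ∈ FBQP ∧ LengthClause f ∧ ValueClause f

/-- The crux is literally `DegreeOnePrimesEscape → Conclusion`. -/
theorem crux_iff : PureCubicClassGroupFBQP ↔ (DegreeOnePrimesEscape → Conclusion) := Iff.rfl

/-! ## Anatomy of a disproof -/

/-- **Anatomy.** Refuting the crux means proving crux #2 (`DegreeOnePrimesEscape`) AND a quantum
lower bound (`¬ Conclusion`: no `FBQP` function outputs the class-number bits). -/
theorem not_crux_iff : ¬ PureCubicClassGroupFBQP ↔ (DegreeOnePrimesEscape ∧ ¬ Conclusion) := by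
  rw [crux_iff, Classical.not_imp]

/-- Triviality mode 1: if crux #2 is refuted, this crux holds vacuously (and the route dies at
item 11543 instead). -/
theorem crux_of_not_escape (h : ¬ DegreeOnePrimesEscape) : PureCubicClassGroupFBQP :=
  fun h' => absurd h' h

/-- Triviality mode 2: the unconditional conclusion (Hallgren/Biasse–Song without GRH — OPEN)
gives the crux. -/
theorem crux_of_conclusion (h : Conclusion) : PureCubicClassGroupFBQP := fun _ => h

/-! ## Bit bookkeeping -/

/-- Equal lists of the `k` low bits force congruence mod `2^k`. -/
theorem mod_two_pow_eq_of_testBit_eq {k a b : ℕ}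
    (h : (fun i : Fin k => a.testBit i.val) = fun i : Fin k => b.testBit i.val) :
    a % 2 ^ k = b % 2 ^ k := by
  apply Nat.eq_of_testBit_eq
  intro i
  rw [Nat.testBit_mod_two_pow, Nat.testBit_mod_two_pow]
  by_cases hi : i < k
  · have := congrFun h ⟨i, hi⟩
    simp only at this
    simp [hi, this]
  · simp [hi]

/-- Two fields forced to share `f x` have class numbers congruent mod `2^(2|x|+8)`. -/
theorem classNumber_mod_eq_of_bits_eq {x : List Bool} {K₁ : Type} [Field K₁] [NumberField K₁]
    {K₂ : Type} [Field K₂] [NumberField K₂] (h : classNumberBits x K₁ = classNumberBits x K₂) :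
    NumberField.classNumber K₁ % 2 ^ (2 * x.length + 8)
      = NumberField.classNumber K₂ % 2 ^ (2 * x.length + 8) :=
  mod_two_pow_eq_of_testBit_eq (List.ofFn_injective h)

/-! ## Degenerate inputs are excluded (no junk instance of the value clause) -/

/-- `decodeNat [] = 0`, a cube: the empty input is vacuous for the value clause. -/
theorem decodeNat_nil : decodeNat [] = 0 := by decide

/-- `decodeNat [true] = 1`, a cube: vacuous. -/
theorem decodeNat_true : decodeNat [true] = 1 := by decide

/-- `decodeNat [false] = 2`: the first genuine input (`K ≅ ℚ(∛2)`, `h = 1`). -/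
theorem decodeNat_false : decodeNat [false] = 2 := by decide

/-- `decodeNat` is not injective (`[false]` and `[false, true]` both decode to `2`), but the value
clause depends on `x` only through `(decodeNat x, |x|)`, so this is harmless. -/
theorem decodeNat_not_injective : ¬ Function.Injective decodeNat := by
  intro h
  have : ([false] : List Bool) = [false, true] := h (by decide)
  simp at this

/-- `2` is not a cube. -/
theorem two_not_cube : ∀ r : ℕ, r ^ 3 ≠ 2 := by
  intro r
  rcases Nat.lt_or_ge r 2 with hr | hr
  · interval_cases r <;> decide
  · have : 2 ^ 3 ≤ r ^ 3 := Nat.pow_le_pow_left hr 3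
    omega

/-! ## Load-bearing analysis

Each hypothesis `H` of the value clause is dropped in turn (`ValueClauseWithoutH`,
`ConclusionWithoutH`, `CruxWithoutH := DegreeOnePrimesEscape → ConclusionWithoutH`).  In every case
the mutilated value clause forces ONE string `f x₀` to equal the class-number bits of TWO admissible
fields with different class numbers, so `ConclusionWithoutH` is false and `CruxWithoutH` is
equivalent to `¬ DegreeOnePrimesEscape` — i.e. the mutilated crux would refute the route's own
crux #2.  The arithmetic facts (class numbers of explicit small fields) are hypotheses here; the
cubic ones are in print (Cohen GTM 138 Table B.3: `h = 1` at `d = −108 = disc ℚ(∛2)`, `h = 2` at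
`d = −283`), and a GRH-free PARI/`bnfcertify` certification is queued as job j004809 Part C (the
shared compute queue was saturated during cycle 1: > 6 h wait, no result yet). -/

/-- Arithmetic input: two cubic number fields whose class numbers are incongruent mod `2^10`
(true in print: Cohen GTM 138 Table B.3 lists `d = −108`, `A = X³ − 2`, `h = 1` and `d = −283`,
`A = X³ + 4X − 1`, `h = 2`; also `h(ℚ(∛7)) = 3` (Dedekind); a GRH-free PARI `bnfcertify` run is
queued as job j004809 Part C; none of this is in Mathlib, hence a hypothesis). -/
def TwoCubicClassNumbersMod : Prop :=
  ∃ (K₁ : Type) (_ : Field K₁) (_ : NumberField K₁) (K₂ : Type) (_ : Field K₂) (_ : NumberField K₂),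
    Module.finrank ℚ K₁ = 3 ∧ Module.finrank ℚ K₂ = 3 ∧
    NumberField.classNumber K₁ % 2 ^ 10 ≠ NumberField.classNumber K₂ % 2 ^ 10

/-- Arithmetic input: two number fields, each containing a cube root of `2`, whose class numbers are
incongruent mod `2^10` (expected: `ℚ(∛2)` has `h = 1` [Cohen GTM 138 Table B.3, `d = −108`] and
some sextic `ℚ(∛2, √-d)` has `h ≢ 1 (mod 2^10)`; the certifying PARI run over
`d ∈ {1,…,31}` is queued as job j004809 Part C — until it reports, this hypothesis is UNVERIFIED
here; not in Mathlib). -/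
def TwoCbrtTwoFieldsMod : Prop :=
  ∃ (K₁ : Type) (_ : Field K₁) (_ : NumberField K₁) (K₂ : Type) (_ : Field K₂) (_ : NumberField K₂),
    (∃ α : K₁, α ^ 3 = 2) ∧ (∃ α : K₂, α ^ 3 = 2) ∧
    NumberField.classNumber K₁ % 2 ^ 10 ≠ NumberField.classNumber K₂ % 2 ^ 10

/-- Value clause WITHOUT the non-cube guard `∀ r, r³ ≠ m`. -/
def ValueClauseWithoutNonCube (f : List Bool → List Bool) : Prop :=
  ∀ (x : List Bool) (K : Type) [Field K] [NumberField K], Module.finrank ℚ K = 3 →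
    (∃ α : K, α ^ 3 = (decodeNat x : K)) → f x = classNumberBits x K

/-- Value clause WITHOUT the cube-root clause `∃ α, α³ = m`. -/
def ValueClauseWithoutCubeRoot (f : List Bool → List Bool) : Prop :=
  ∀ (x : List Bool) (K : Type) [Field K] [NumberField K], Module.finrank ℚ K = 3 →
    (∀ r : ℕ, r ^ 3 ≠ decodeNat x) → f x = classNumberBits x K

/-- Value clause WITHOUT the degree clause `finrank ℚ K = 3`. -/
def ValueClauseWithoutDegree (f : List Bool → List Bool) : Prop :=
  ∀ (x : List Bool) (K : Type) [Field K] [NumberField K],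
    (∀ r : ℕ, r ^ 3 ≠ decodeNat x) → (∃ α : K, α ^ 3 = (decodeNat x : K)) →
    f x = classNumberBits x K

/-- `Conclusion` with the non-cube guard dropped. -/
def ConclusionWithoutNonCube : Prop :=
  ∃ f : List Bool → List Bool, f ∈ FBQP ∧ LengthClause f ∧ ValueClauseWithoutNonCube f

/-- `Conclusion` with the cube-root clause dropped. -/
def ConclusionWithoutCubeRoot : Prop :=
  ∃ f : List Bool → List Bool, f ∈ FBQP ∧ LengthClause f ∧ ValueClauseWithoutCubeRoot f

/-- `Conclusion` with the degree clause dropped. -/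
def ConclusionWithoutDegree : Prop :=
  ∃ f : List Bool → List Bool, f ∈ FBQP ∧ LengthClause f ∧ ValueClauseWithoutDegree f

/-- The crux with the non-cube guard dropped. -/
def PureCubicClassGroupFBQPWithoutNonCube : Prop := DegreeOnePrimesEscape → ConclusionWithoutNonCube

/-- The crux with the cube-root clause dropped. -/
def PureCubicClassGroupFBQPWithoutCubeRoot : Prop := DegreeOnePrimesEscape → ConclusionWithoutCubeRoot

/-- The crux with the degree clause dropped. -/
def PureCubicClassGroupFBQPWithoutDegree : Prop := DegreeOnePrimesEscape → ConclusionWithoutDegree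

/-- Every field contains a cube root of `decodeNat [true] = 1`. -/
theorem exists_cube_root_decodeNat_true (K : Type) [Field K] :
    ∃ α : K, α ^ 3 = (decodeNat [true] : K) :=
  ⟨1, by rw [decodeNat_true, Nat.cast_one, one_pow]⟩

/-- `decodeNat [false] = 2` is not a cube. -/
theorem decodeNat_false_not_cube : ∀ r : ℕ, r ^ 3 ≠ decodeNat [false] := by
  rw [decodeNat_false]; exact two_not_cube

/-- A cube root of `2` is a cube root of `decodeNat [false]`. -/
theorem exists_cube_root_decodeNat_false {K : Type} [Field K] {α : K} (h : α ^ 3 = 2) :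
    ∃ β : K, β ^ 3 = (decodeNat [false] : K) :=
  ⟨α, by rw [decodeNat_false, Nat.cast_ofNat, h]⟩

/-- Without the non-cube guard the value clause is inconsistent already at `x = [true]` (`m = 1`,
`α = 1` in every field): two cubic fields with class numbers incongruent mod `2^10` cannot share
`f [true]`. -/
theorem not_valueClauseWithoutNonCube_of {K₁ K₂ : Type} [Field K₁] [NumberField K₁] [Field K₂]
    [NumberField K₂] (h1 : Module.finrank ℚ K₁ = 3) (h2 : Module.finrank ℚ K₂ = 3)
    (hne : NumberField.classNumber K₁ % 2 ^ 10 ≠ NumberField.classNumber K₂ % 2 ^ 10)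
    (f : List Bool → List Bool) : ¬ ValueClauseWithoutNonCube f := by
  intro hf
  have e1 := hf [true] K₁ h1 (exists_cube_root_decodeNat_true K₁)
  have e2 := hf [true] K₂ h2 (exists_cube_root_decodeNat_true K₂)
  -- (elaborate the congruence at its own modulus first: unifying `2 ^ (2*|x|+8)` with `2 ^ 10`
  -- while `x` is still a metavariable makes `whnf` unfold `classNumber`, which times out)
  have h3 : NumberField.classNumber K₁ % 2 ^ 10 = NumberField.classNumber K₂ % 2 ^ 10 := by
    simpa using classNumber_mod_eq_of_bits_eq (e1.symm.trans e2)
  exact hne h3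

/-- Without the cube-root clause the value clause is inconsistent at `x = [false]` (`m = 2`): every
cubic field, whether or not it contains `∛2`, would share the ten low class-number bits. -/
theorem not_valueClauseWithoutCubeRoot_of {K₁ K₂ : Type} [Field K₁] [NumberField K₁] [Field K₂]
    [NumberField K₂] (h1 : Module.finrank ℚ K₁ = 3) (h2 : Module.finrank ℚ K₂ = 3)
    (hne : NumberField.classNumber K₁ % 2 ^ 10 ≠ NumberField.classNumber K₂ % 2 ^ 10)
    (f : List Bool → List Bool) : ¬ ValueClauseWithoutCubeRoot f := by
  intro hf
  have e1 := hf [false] K₁ h1 decodeNat_false_not_cube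
  have e2 := hf [false] K₂ h2 decodeNat_false_not_cube
  -- (elaborate the congruence at its own modulus first: unifying `2 ^ (2*|x|+8)` with `2 ^ 10`
  -- while `x` is still a metavariable makes `whnf` unfold `classNumber`, which times out)
  have h3 : NumberField.classNumber K₁ % 2 ^ 10 = NumberField.classNumber K₂ % 2 ^ 10 := by
    simpa using classNumber_mod_eq_of_bits_eq (e1.symm.trans e2)
  exact hne h3

/-- Without the degree clause the value clause is inconsistent at `x = [false]` (`m = 2`): two
fields of any degrees containing `∛2`, with class numbers incongruent mod `2^10`, cannot share
`f [false]`. -/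
theorem not_valueClauseWithoutDegree_of {K₁ K₂ : Type} [Field K₁] [NumberField K₁] [Field K₂]
    [NumberField K₂] {α₁ : K₁} (h1 : α₁ ^ 3 = 2) {α₂ : K₂} (h2 : α₂ ^ 3 = 2)
    (hne : NumberField.classNumber K₁ % 2 ^ 10 ≠ NumberField.classNumber K₂ % 2 ^ 10)
    (f : List Bool → List Bool) : ¬ ValueClauseWithoutDegree f := by
  intro hf
  have e1 := hf [false] K₁ decodeNat_false_not_cube (exists_cube_root_decodeNat_false h1)
  have e2 := hf [false] K₂ decodeNat_false_not_cube (exists_cube_root_decodeNat_false h2)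
  -- (elaborate the congruence at its own modulus first: unifying `2 ^ (2*|x|+8)` with `2 ^ 10`
  -- while `x` is still a metavariable makes `whnf` unfold `classNumber`, which times out)
  have h3 : NumberField.classNumber K₁ % 2 ^ 10 = NumberField.classNumber K₂ % 2 ^ 10 := by
    simpa using classNumber_mod_eq_of_bits_eq (e1.symm.trans e2)
  exact hne h3

/-- **Any proof must use the non-cube guard**: without it the conclusion is false outright … -/
theorem not_conclusionWithoutNonCube (hA : TwoCubicClassNumbersMod) : ¬ ConclusionWithoutNonCube := by
  rintro ⟨f, -, -, hf⟩
  obtain ⟨K₁, i₁, i₂, K₂, i₃, i₄, h1, h2, hne⟩ := hA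
  exact @not_valueClauseWithoutNonCube_of K₁ K₂ i₁ i₂ i₃ i₄ h1 h2 hne f hf

/-- … and the mutilated crux says exactly `¬ DegreeOnePrimesEscape` (it would refute crux #2). -/
theorem cruxWithoutNonCube_iff (hA : TwoCubicClassNumbersMod) :
    PureCubicClassGroupFBQPWithoutNonCube ↔ ¬ DegreeOnePrimesEscape :=
  ⟨fun h hE => not_conclusionWithoutNonCube hA (h hE), fun h hE => absurd hE h⟩

/-- **Any proof must use the cube-root clause.** -/
theorem not_conclusionWithoutCubeRoot (hA : TwoCubicClassNumbersMod) :
    ¬ ConclusionWithoutCubeRoot := by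
  rintro ⟨f, -, -, hf⟩
  obtain ⟨K₁, i₁, i₂, K₂, i₃, i₄, h1, h2, hne⟩ := hA
  exact @not_valueClauseWithoutCubeRoot_of K₁ K₂ i₁ i₂ i₃ i₄ h1 h2 hne f hf

/-- The crux without the cube-root clause is `¬ DegreeOnePrimesEscape`. -/
theorem cruxWithoutCubeRoot_iff (hA : TwoCubicClassNumbersMod) :
    PureCubicClassGroupFBQPWithoutCubeRoot ↔ ¬ DegreeOnePrimesEscape :=
  ⟨fun h hE => not_conclusionWithoutCubeRoot hA (h hE), fun h hE => absurd hE h⟩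

/-- **Any proof must use the degree clause.** -/
theorem not_conclusionWithoutDegree (hB : TwoCbrtTwoFieldsMod) : ¬ ConclusionWithoutDegree := by
  rintro ⟨f, -, -, hf⟩
  obtain ⟨K₁, i₁, i₂, K₂, i₃, i₄, ⟨α₁, h1⟩, ⟨α₂, h2⟩, hne⟩ := hB
  exact @not_valueClauseWithoutDegree_of K₁ K₂ i₁ i₂ i₃ i₄ α₁ h1 α₂ h2 hne f hf

/-- The crux without the degree clause is `¬ DegreeOnePrimesEscape`. -/
theorem cruxWithoutDegree_iff (hB : TwoCbrtTwoFieldsMod) :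
    PureCubicClassGroupFBQPWithoutDegree ↔ ¬ DegreeOnePrimesEscape :=
  ⟨fun h hE => not_conclusionWithoutDegree hB (h hE), fun h hE => absurd hE h⟩


/-! ## Dropping `f ∈ FBQP`: the rest of the conclusion is TRUE (consistency of the value clause)

The value clause pins `f x` on admissible inputs only up to the choice of the admissible field `K`;
we prove that this choice is immaterial — all admissible `K` at a given `x` are isomorphic to
`ℚ[X]/(X³ − m)` and the class number is an isomorphism invariant — so a canonical candidate
`canonicalF` satisfies the length and value clauses.  Consequently the crux is EQUIVALENT to the pure
complexity claim "some `f ∈ FBQP` agrees with `canonicalF` on admissible inputs"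
(`conclusion_iff_canonical`), and no refutation can come from the arithmetic side conditions. -/

section transport

variable {A B : Type*} [CommRing A] [IsDedekindDomain A] [CommRing B] [IsDedekindDomain B]

/-- `ClassGroup.extendedHom A A` is the identity. -/
theorem extendedHom_self_apply (c : ClassGroup A) : ClassGroup.extendedHom A A c = c := by
  obtain ⟨I, rfl⟩ := ClassGroup.mk0_surjective c
  rw [ClassGroup.extendedHom_mk0]
  congr 1
  ext1
  simp [Ideal.map_id]

/-- Isomorphic Dedekind domains have class groups of the same (finite) cardinality: the maps
`ClassGroup.extendedHom` along `f` and `f⁻¹` are mutually inverse. -/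
theorem card_classGroup_eq_of_ringEquiv [Fintype (ClassGroup A)] [Fintype (ClassGroup B)]
    (f : A ≃+* B) : Fintype.card (ClassGroup A) = Fintype.card (ClassGroup B) := by
  letI : Algebra A B := f.toRingHom.toAlgebra
  letI : Algebra B A := f.symm.toRingHom.toAlgebra
  haveI : FaithfulSMul A B := (faithfulSMul_iff_algebraMap_injective A B).mpr f.injective
  haveI : FaithfulSMul B A := (faithfulSMul_iff_algebraMap_injective B A).mpr f.symm.injective
  haveI : IsScalarTower A B A :=
    IsScalarTower.of_algebraMap_eq (fun a => (f.symm_apply_apply a).symm)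
  haveI : IsScalarTower B A B :=
    IsScalarTower.of_algebraMap_eq (fun b => (f.apply_symm_apply b).symm)
  refine Fintype.card_congr
    { toFun := ClassGroup.extendedHom A B
      invFun := ClassGroup.extendedHom B A
      left_inv := fun c => ?_
      right_inv := fun c => ?_ }
  · rw [ClassGroup.extendedHom_comp_apply, extendedHom_self_apply]
  · rw [ClassGroup.extendedHom_comp_apply, extendedHom_self_apply]

end transport

/-- **The class number of a number field is an isomorphism invariant.** -/
theorem classNumber_eq_of_ringEquiv {K L : Type*} [Field K] [NumberField K] [Field L]
    [NumberField L] (e : K ≃+* L) : NumberField.classNumber K = NumberField.classNumber L :=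
  card_classGroup_eq_of_ringEquiv (NumberField.RingOfIntegers.mapRingEquiv e)

section cubic

open Polynomial

/-- A natural number that is not the cube of a natural number is not the cube of a rational
number (rational cube roots of integers are integers). -/
theorem not_rat_cube {m : ℕ} (hm : ∀ r : ℕ, r ^ 3 ≠ m) (b : ℚ) : b ^ 3 ≠ (m : ℚ) := by
  intro hb
  have hx : ((b : ℝ)) ^ 3 = ((m : ℤ) : ℝ) := by push_cast; exact_mod_cast hb
  obtain ⟨y, hy⟩ : ∃ y : ℤ, (b : ℝ) = y := by
    by_contra h
    exact b.not_irrational (irrational_nrt_of_notint_nrt 3 m hx h (by norm_num))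
  have hyb : b = y := by exact_mod_cast hy
  have hy3 : y ^ 3 = (m : ℤ) := by rw [hyb] at hb; exact_mod_cast hb
  have hy0 : 0 ≤ y := by
    by_contra hneg
    push Not at hneg
    have : y ^ 3 < 0 := Odd.pow_neg (by decide) hneg
    omega
  lift y to ℕ using hy0
  exact hm y (by exact_mod_cast hy3)

/-- `X³ − m` is irreducible over `ℚ` when `m : ℕ` is not a cube (Kummer criterion at the prime
`3`). -/
theorem irreducible_cubic {m : ℕ} (hm : ∀ r : ℕ, r ^ 3 ≠ m) :
    Irreducible (X ^ 3 - C (m : ℚ) : ℚ[X]) :=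
  X_pow_sub_C_irreducible_of_prime Nat.prime_three (not_rat_cube hm)

/-- Every cubic number field containing a cube root of the non-cube `m` is `ℚ[X]/(X³ − m)`:
the lift `ℚ[X]/(X³ − m) →ₐ[ℚ] K` of `X ↦ α` is injective (field) between `ℚ`-spaces of
dimension `3`, hence bijective. -/
theorem nonempty_algEquiv_adjoinRoot {m : ℕ} (hm : ∀ r : ℕ, r ^ 3 ≠ m)
    (K : Type*) [Field K] [NumberField K] (hK : Module.finrank ℚ K = 3) {α : K}
    (hα : α ^ 3 = (m : K)) : Nonempty (AdjoinRoot (X ^ 3 - C (m : ℚ)) ≃ₐ[ℚ] K) := by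
  have hp : Irreducible (X ^ 3 - C (m : ℚ) : ℚ[X]) := irreducible_cubic hm
  haveI := Fact.mk hp
  have hp0 : (X ^ 3 - C (m : ℚ) : ℚ[X]) ≠ 0 := hp.ne_zero
  have hroot : (X ^ 3 - C (m : ℚ) : ℚ[X]).eval₂ (↑(Algebra.ofId ℚ K) : ℚ →+* K) α = 0 := by
    simp [hα]
  let φ : AdjoinRoot (X ^ 3 - C (m : ℚ)) →ₐ[ℚ] K :=
    AdjoinRoot.liftAlgHom (X ^ 3 - C (m : ℚ)) (Algebra.ofId ℚ K) α hroot
  have hinj : Function.Injective φ := φ.toRingHom.injective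
  have hdeg : (X ^ 3 - C (m : ℚ) : ℚ[X]).natDegree = 3 := natDegree_X_pow_sub_C
  have hfin : Module.finrank ℚ (AdjoinRoot (X ^ 3 - C (m : ℚ))) = 3 := by
    rw [(AdjoinRoot.powerBasis hp0).finrank, AdjoinRoot.powerBasis_dim, hdeg]
  haveI : FiniteDimensional ℚ (AdjoinRoot (X ^ 3 - C (m : ℚ))) :=
    (AdjoinRoot.powerBasis hp0).finite
  have hsurj : Function.Surjective φ :=
    (LinearMap.injective_iff_surjective_of_finrank_eq_finrank (f := φ.toLinearMap)
      (by rw [hfin, hK])).mp hinj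
  exact ⟨AlgEquiv.ofBijective φ ⟨hinj, hsurj⟩⟩

/-- Two cubic number fields containing cube roots of the same non-cube `m` are isomorphic. -/
theorem nonempty_ringEquiv_of_cubic {m : ℕ} (hm : ∀ r : ℕ, r ^ 3 ≠ m)
    (K₁ : Type*) [Field K₁] [NumberField K₁] (h₁ : Module.finrank ℚ K₁ = 3) {α₁ : K₁}
    (hα₁ : α₁ ^ 3 = (m : K₁))
    (K₂ : Type*) [Field K₂] [NumberField K₂] (h₂ : Module.finrank ℚ K₂ = 3) {α₂ : K₂}
    (hα₂ : α₂ ^ 3 = (m : K₂)) : Nonempty (K₁ ≃+* K₂) := by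
  obtain ⟨e₁⟩ := nonempty_algEquiv_adjoinRoot hm K₁ h₁ hα₁
  obtain ⟨e₂⟩ := nonempty_algEquiv_adjoinRoot hm K₂ h₂ hα₂
  exact ⟨(e₁.symm.trans e₂).toRingEquiv⟩

/-- **All admissible fields at a given input have the same class number.** -/
theorem classNumber_eq_of_cubic {m : ℕ} (hm : ∀ r : ℕ, r ^ 3 ≠ m)
    (K₁ : Type*) [Field K₁] [NumberField K₁] (h₁ : Module.finrank ℚ K₁ = 3) {α₁ : K₁}
    (hα₁ : α₁ ^ 3 = (m : K₁))
    (K₂ : Type*) [Field K₂] [NumberField K₂] (h₂ : Module.finrank ℚ K₂ = 3) {α₂ : K₂}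
    (hα₂ : α₂ ^ 3 = (m : K₂)) : NumberField.classNumber K₁ = NumberField.classNumber K₂ := by
  obtain ⟨e⟩ := nonempty_ringEquiv_of_cubic hm K₁ h₁ hα₁ K₂ h₂ hα₂
  exact classNumber_eq_of_ringEquiv e

end cubic

/-- Admissible data at input `x`: a cubic number field with a cube root of the non-cube
`decodeNat x`. -/
structure Admissible (x : List Bool) : Type 1 where
  /-- the field -/
  K : Type
  [fld : Field K]
  [nf : NumberField K]
  rank : Module.finrank ℚ K = 3
  noncube : ∀ r : ℕ, r ^ 3 ≠ decodeNat x
  /-- a cube root of `decodeNat x` in `K` -/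
  α : K
  root : α ^ 3 = (decodeNat x : K)

attribute [instance] Admissible.fld Admissible.nf

open scoped Classical in
/-- The canonical candidate: class-number bits of SOME admissible field when there is one, zeros
otherwise (its complexity is the whole question; as a function it is well defined). -/
def canonicalF (x : List Bool) : List Bool :=
  if h : Nonempty (Admissible x) then classNumberBits x h.some.K
  else List.replicate (2 * x.length + 8) false

/-- `canonicalF` has the required output length. -/
theorem canonicalF_length : LengthClause canonicalF := by
  intro x
  unfold canonicalF
  split <;> simp [classNumberBits]

/-- `canonicalF` satisfies the value clause: the choice of admissible field is immaterial. -/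
theorem canonicalF_value : ValueClause canonicalF := by
  intro x K _ _ hK hm hα
  obtain ⟨α, hα⟩ := hα
  have hne : Nonempty (Admissible x) := ⟨⟨K, hK, hm, α, hα⟩⟩
  rw [show canonicalF x = classNumberBits x hne.some.K from dif_pos hne]
  simp only [classNumberBits]
  rw [classNumber_eq_of_cubic hne.some.noncube hne.some.K hne.some.rank hne.some.root K hK hα]

/-- **Dropping `f ∈ FBQP` from the conclusion leaves a TRUE statement**: the length and value
clauses are jointly satisfiable.  All the content of the crux is the complexity claim. -/
theorem conclusionWithoutFBQP : ∃ f : List Bool → List Bool, LengthClause f ∧ ValueClause f :=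
  ⟨canonicalF, canonicalF_length, canonicalF_value⟩

/-- The value clause says exactly: `f` agrees with `canonicalF` on admissible inputs. -/
theorem valueClause_iff (f : List Bool → List Bool) :
    ValueClause f ↔ ∀ x, Nonempty (Admissible x) → f x = canonicalF x := by
  constructor
  · intro hf x hne
    obtain ⟨a⟩ := hne
    rw [hf x a.K a.rank a.noncube ⟨a.α, a.root⟩]
    exact (canonicalF_value x a.K a.rank a.noncube ⟨a.α, a.root⟩).symm
  · intro hf x K _ _ hK hm hα
    obtain ⟨α, hα'⟩ := hα
    rw [hf x ⟨⟨K, hK, hm, α, hα'⟩⟩]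
    exact canonicalF_value x K hK hm ⟨α, hα'⟩

/-- **Reformulation of the crux as a pure complexity claim**: some `FBQP` function of output
length `2|x|+8` agrees with the (well-defined) class-number-bits function `canonicalF` on
admissible inputs. -/
theorem conclusion_iff_canonical :
    Conclusion ↔ ∃ f : List Bool → List Bool, f ∈ FBQP ∧ LengthClause f ∧
      ∀ x, Nonempty (Admissible x) → f x = canonicalF x := by
  simp only [Conclusion, valueClause_iff]

/-- **What a prover has to do**: it suffices to put the single explicit function `canonicalF`
(class-number bits on admissible inputs, zeros elsewhere — inadmissibility is a cube test, in `P`)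
into `FBQP`. -/
theorem conclusion_of_canonicalF_mem (h : canonicalF ∈ FBQP) : Conclusion :=
  ⟨canonicalF, h, canonicalF_length, canonicalF_value⟩

/-- … and then the crux follows without touching its hypothesis (which is needed only INSIDE the
proof of `canonicalF ∈ FBQP`, for the generation step of the algorithm). -/
theorem crux_of_canonicalF_mem (h : canonicalF ∈ FBQP) : PureCubicClassGroupFBQP :=
  crux_of_conclusion (conclusion_of_canonicalF_mem h)


/-! ## Cycle 2 (gen 2): padded inputs and MODULUS-FREE load-bearing hypotheses

Cycle 1 probed the guards at the shortest inputs (`x = [true]`, `x = [false]`: ten output bits),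
which forced the arithmetic inputs to be stated modulo `2^10`.  Mathlib's `decodeNat` reads
`List.replicate L false` as `2^L` (the terminating `true` of the little-endian expansion is
implicit), so the value clause can be probed at inputs of ANY length whose `m` is a prescribed
power of two; at length `L` the clause pins `2L + 8` bits — more than the class numbers involved
once `L` exceeds them — and the congruences become EQUALITIES.  Hence the weakest conceivable
arithmetic inputs suffice: two cubic fields with different class numbers (`TwoCubicClassNumbers`;
in print `h(ℚ(∛2)) = 1`, `h(ℚ(∛7)) = 3`), resp. two fields containing `∛2` with different class
numbers (`TwoCbrtTwoFields`).  The cycle-1 hypotheses imply these (`…_of_mod`). -/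

/-- `decodePosNum` reads `L` zeros as `2^L`. -/
theorem decodePosNum_replicate_false (L : ℕ) :
    ((Computability.decodePosNum (List.replicate L false) : PosNum) : ℕ) = 2 ^ L := by
  induction L with
  | zero => rfl
  | succ L ih =>
    rw [List.replicate_succ, Computability.decodePosNum, PosNum.cast_bit0, ih]
    ring

/-- `decodeNat` reads `L + 1` zeros as `2^(L+1)` (for `L + 1 = 0` it would read `0`). -/
theorem decodeNat_replicate_false (L : ℕ) :
    decodeNat (List.replicate (L + 1) false) = 2 ^ (L + 1) := by
  have h : Computability.decodeNum (List.replicate (L + 1) false)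
      = Num.pos (Computability.decodePosNum (List.replicate (L + 1) false)) := by
    simp [Computability.decodeNum]
  show ((Computability.decodeNum (List.replicate (L + 1) false) : Num) : ℕ) = 2 ^ (L + 1)
  rw [h]
  exact decodePosNum_replicate_false (L + 1)

/-- A power of two whose exponent is not a multiple of `3` is not a cube. -/
theorem two_pow_not_cube {N : ℕ} (hN : N % 3 ≠ 0) : ∀ r : ℕ, r ^ 3 ≠ 2 ^ N := by
  intro r hr
  have hdvd : r ∣ 2 ^ N := ⟨r ^ 2, by rw [← hr]; ring⟩
  obtain ⟨a, -, rfl⟩ := (Nat.dvd_prime_pow Nat.prime_two).1 hdvd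
  rw [← pow_mul] at hr
  have := Nat.pow_right_injective (le_refl 2) hr
  omega

/-- Equal lists of the `k` low bits of two numbers `< 2^k` force equality. -/
theorem eq_of_testBit_eq_of_lt {k a b : ℕ} (ha : a < 2 ^ k) (hb : b < 2 ^ k)
    (h : (fun i : Fin k => a.testBit i.val) = fun i : Fin k => b.testBit i.val) : a = b := by
  have := mod_two_pow_eq_of_testBit_eq h
  rwa [Nat.mod_eq_of_lt ha, Nat.mod_eq_of_lt hb] at this

/-- Two fields forced to share `f x`, whose class numbers fit into `2|x|+8` bits, have EQUAL class
numbers. -/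
theorem classNumber_eq_of_bits_eq {x : List Bool} {K₁ : Type} [Field K₁] [NumberField K₁]
    {K₂ : Type} [Field K₂] [NumberField K₂] (h : classNumberBits x K₁ = classNumberBits x K₂)
    (h₁ : NumberField.classNumber K₁ < 2 ^ (2 * x.length + 8))
    (h₂ : NumberField.classNumber K₂ < 2 ^ (2 * x.length + 8)) :
    NumberField.classNumber K₁ = NumberField.classNumber K₂ :=
  eq_of_testBit_eq_of_lt h₁ h₂ (List.ofFn_injective h)

/-- `n ≤ j ≤ e ⟹ n < 2^e`. -/
theorem lt_two_pow_of_le_of_le {n j e : ℕ} (h₁ : n ≤ j) (h₂ : j ≤ e) : n < 2 ^ e :=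
  lt_of_le_of_lt h₁ (lt_of_lt_of_le Nat.lt_two_pow_self (Nat.pow_le_pow_right two_pos h₂))

/-- Padded CUBE input: `3j+3` zeros, decoding to `(2^(j+1))³`. -/
def cubeInput (j : ℕ) : List Bool := List.replicate (3 * j + 3) false

/-- Padded NON-CUBE input: `3j+4` zeros, decoding to `2 · (2^(j+1))³`. -/
def nonCubeInput (j : ℕ) : List Bool := List.replicate (3 * j + 4) false

theorem cubeInput_length (j : ℕ) : (cubeInput j).length = 3 * j + 3 := List.length_replicate

theorem nonCubeInput_length (j : ℕ) : (nonCubeInput j).length = 3 * j + 4 := List.length_replicate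

theorem decodeNat_cubeInput (j : ℕ) : decodeNat (cubeInput j) = 2 ^ (3 * j + 3) :=
  decodeNat_replicate_false (3 * j + 2)

theorem decodeNat_nonCubeInput (j : ℕ) : decodeNat (nonCubeInput j) = 2 ^ (3 * j + 4) :=
  decodeNat_replicate_false (3 * j + 3)

/-- Every field contains a cube root of `decodeNat (cubeInput j) = (2^(j+1))³`. -/
theorem exists_cube_root_cubeInput (K : Type) [Field K] (j : ℕ) :
    ∃ α : K, α ^ 3 = (decodeNat (cubeInput j) : K) :=
  ⟨(2 : K) ^ (j + 1), by rw [decodeNat_cubeInput]; push_cast; ring⟩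

/-- `decodeNat (nonCubeInput j) = 2^(3j+4)` is not a cube. -/
theorem nonCubeInput_not_cube (j : ℕ) : ∀ r : ℕ, r ^ 3 ≠ decodeNat (nonCubeInput j) := by
  rw [decodeNat_nonCubeInput]; exact two_pow_not_cube (by omega)

/-- A field containing `∛2` contains a cube root of `decodeNat (nonCubeInput j) = 2 · (2^(j+1))³`. -/
theorem exists_cube_root_nonCubeInput {K : Type} [Field K] {β : K} (hβ : β ^ 3 = 2) (j : ℕ) :
    ∃ α : K, α ^ 3 = (decodeNat (nonCubeInput j) : K) :=
  ⟨2 ^ (j + 1) * β, by rw [decodeNat_nonCubeInput]; push_cast; rw [mul_pow, hβ]; ring⟩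

/-- Arithmetic input, MODULUS-FREE form: two cubic number fields with different class numbers
(in print: `h(ℚ(∛2)) = 1`, `h(ℚ(∛7)) = 3`; Cohen GTM 138 Table B.3 has `h = 1` at `d = −108`,
`h = 2` at `d = −283`).  Its negation says that ALL cubic number fields have the same class
number. -/
def TwoCubicClassNumbers : Prop :=
  ∃ (K₁ : Type) (_ : Field K₁) (_ : NumberField K₁) (K₂ : Type) (_ : Field K₂) (_ : NumberField K₂),
    Module.finrank ℚ K₁ = 3 ∧ Module.finrank ℚ K₂ = 3 ∧
    NumberField.classNumber K₁ ≠ NumberField.classNumber K₂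

/-- Arithmetic input, MODULUS-FREE form: two number fields containing a cube root of `2` with
different class numbers (e.g. `ℚ(∛2)`, `h = 1`, against `ℚ(∛2, √−23)`, `3 ∣ h` since the norm
map onto `Cl(ℚ(√−23)) ≅ ℤ/3` is surjective for the ramified cubic extension). -/
def TwoCbrtTwoFields : Prop :=
  ∃ (K₁ : Type) (_ : Field K₁) (_ : NumberField K₁) (K₂ : Type) (_ : Field K₂) (_ : NumberField K₂),
    (∃ α : K₁, α ^ 3 = 2) ∧ (∃ α : K₂, α ^ 3 = 2) ∧
    NumberField.classNumber K₁ ≠ NumberField.classNumber K₂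

/-- The cycle-1 input implies the modulus-free one. -/
theorem twoCubicClassNumbers_of_mod (h : TwoCubicClassNumbersMod) : TwoCubicClassNumbers := by
  obtain ⟨K₁, i₁, i₂, K₂, i₃, i₄, h1, h2, hne⟩ := h
  exact ⟨K₁, i₁, i₂, K₂, i₃, i₄, h1, h2, fun h => hne (by rw [h])⟩

/-- The cycle-1 input implies the modulus-free one. -/
theorem twoCbrtTwoFields_of_mod (h : TwoCbrtTwoFieldsMod) : TwoCbrtTwoFields := by
  obtain ⟨K₁, i₁, i₂, K₂, i₃, i₄, h1, h2, hne⟩ := h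
  exact ⟨K₁, i₁, i₂, K₂, i₃, i₄, h1, h2, fun h => hne (by rw [h])⟩

/-- Without the non-cube guard, ANY two cubic fields with different class numbers `h₁ ≠ h₂` break
the value clause: at the padded cube input `cubeInput (h₁ + h₂)` both are admissible (cube root
`2^(j+1)`), and `2|x|+8 > h₁ + h₂` bits pin the class numbers outright. -/
theorem not_valueClauseWithoutNonCube_of_ne {K₁ K₂ : Type} [Field K₁] [NumberField K₁] [Field K₂]
    [NumberField K₂] (h1 : Module.finrank ℚ K₁ = 3) (h2 : Module.finrank ℚ K₂ = 3)
    (hne : NumberField.classNumber K₁ ≠ NumberField.classNumber K₂)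
    (f : List Bool → List Bool) : ¬ ValueClauseWithoutNonCube f := by
  intro hf
  have e1 := hf (cubeInput (NumberField.classNumber K₁ + NumberField.classNumber K₂)) K₁ h1
    (exists_cube_root_cubeInput K₁ _)
  have e2 := hf (cubeInput (NumberField.classNumber K₁ + NumberField.classNumber K₂)) K₂ h2
    (exists_cube_root_cubeInput K₂ _)
  refine hne (classNumber_eq_of_bits_eq (e1.symm.trans e2) ?_ ?_) <;>
  · rw [cubeInput_length]
    exact lt_two_pow_of_le_of_le (j := NumberField.classNumber K₁ + NumberField.classNumber K₂)
      (by omega) (by omega)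

/-- Without the cube-root clause, ANY two cubic fields with different class numbers break the
value clause at the padded non-cube input `nonCubeInput (h₁ + h₂)` (no cube root is asked for). -/
theorem not_valueClauseWithoutCubeRoot_of_ne {K₁ K₂ : Type} [Field K₁] [NumberField K₁] [Field K₂]
    [NumberField K₂] (h1 : Module.finrank ℚ K₁ = 3) (h2 : Module.finrank ℚ K₂ = 3)
    (hne : NumberField.classNumber K₁ ≠ NumberField.classNumber K₂)
    (f : List Bool → List Bool) : ¬ ValueClauseWithoutCubeRoot f := by
  intro hf
  have e1 := hf (nonCubeInput (NumberField.classNumber K₁ + NumberField.classNumber K₂)) K₁ h1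
    (nonCubeInput_not_cube _)
  have e2 := hf (nonCubeInput (NumberField.classNumber K₁ + NumberField.classNumber K₂)) K₂ h2
    (nonCubeInput_not_cube _)
  refine hne (classNumber_eq_of_bits_eq (e1.symm.trans e2) ?_ ?_) <;>
  · rw [nonCubeInput_length]
    exact lt_two_pow_of_le_of_le (j := NumberField.classNumber K₁ + NumberField.classNumber K₂)
      (by omega) (by omega)

/-- Without the degree clause, ANY two fields containing `∛2` with different class numbers break
the value clause at the padded non-cube input `nonCubeInput (h₁ + h₂)` (cube root `2^(j+1) ∛2`). -/
theorem not_valueClauseWithoutDegree_of_ne {K₁ K₂ : Type} [Field K₁] [NumberField K₁] [Field K₂]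
    [NumberField K₂] {β₁ : K₁} (h1 : β₁ ^ 3 = 2) {β₂ : K₂} (h2 : β₂ ^ 3 = 2)
    (hne : NumberField.classNumber K₁ ≠ NumberField.classNumber K₂)
    (f : List Bool → List Bool) : ¬ ValueClauseWithoutDegree f := by
  intro hf
  have e1 := hf (nonCubeInput (NumberField.classNumber K₁ + NumberField.classNumber K₂)) K₁
    (nonCubeInput_not_cube _) (exists_cube_root_nonCubeInput h1 _)
  have e2 := hf (nonCubeInput (NumberField.classNumber K₁ + NumberField.classNumber K₂)) K₂
    (nonCubeInput_not_cube _) (exists_cube_root_nonCubeInput h2 _)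
  refine hne (classNumber_eq_of_bits_eq (e1.symm.trans e2) ?_ ?_) <;>
  · rw [nonCubeInput_length]
    exact lt_two_pow_of_le_of_le (j := NumberField.classNumber K₁ + NumberField.classNumber K₂)
      (by omega) (by omega)

/-- **Any proof must use the non-cube guard** (modulus-free form). -/
theorem not_conclusionWithoutNonCube' (hA : TwoCubicClassNumbers) : ¬ ConclusionWithoutNonCube := by
  rintro ⟨f, -, -, hf⟩
  obtain ⟨K₁, i₁, i₂, K₂, i₃, i₄, h1, h2, hne⟩ := hA
  exact @not_valueClauseWithoutNonCube_of_ne K₁ K₂ i₁ i₂ i₃ i₄ h1 h2 hne f hf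

/-- The crux without the non-cube guard is `¬ DegreeOnePrimesEscape` (modulus-free form). -/
theorem cruxWithoutNonCube_iff' (hA : TwoCubicClassNumbers) :
    PureCubicClassGroupFBQPWithoutNonCube ↔ ¬ DegreeOnePrimesEscape :=
  ⟨fun h hE => not_conclusionWithoutNonCube' hA (h hE), fun h hE => absurd hE h⟩

/-- **Any proof must use the cube-root clause** (modulus-free form). -/
theorem not_conclusionWithoutCubeRoot' (hA : TwoCubicClassNumbers) :
    ¬ ConclusionWithoutCubeRoot := by
  rintro ⟨f, -, -, hf⟩
  obtain ⟨K₁, i₁, i₂, K₂, i₃, i₄, h1, h2, hne⟩ := hA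
  exact @not_valueClauseWithoutCubeRoot_of_ne K₁ K₂ i₁ i₂ i₃ i₄ h1 h2 hne f hf

/-- The crux without the cube-root clause is `¬ DegreeOnePrimesEscape` (modulus-free form). -/
theorem cruxWithoutCubeRoot_iff' (hA : TwoCubicClassNumbers) :
    PureCubicClassGroupFBQPWithoutCubeRoot ↔ ¬ DegreeOnePrimesEscape :=
  ⟨fun h hE => not_conclusionWithoutCubeRoot' hA (h hE), fun h hE => absurd hE h⟩

/-- **Any proof must use the degree clause** (modulus-free form). -/
theorem not_conclusionWithoutDegree' (hB : TwoCbrtTwoFields) : ¬ ConclusionWithoutDegree := by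
  rintro ⟨f, -, -, hf⟩
  obtain ⟨K₁, i₁, i₂, K₂, i₃, i₄, ⟨β₁, h1⟩, ⟨β₂, h2⟩, hne⟩ := hB
  exact @not_valueClauseWithoutDegree_of_ne K₁ K₂ i₁ i₂ i₃ i₄ β₁ h1 β₂ h2 hne f hf

/-- The crux without the degree clause is `¬ DegreeOnePrimesEscape` (modulus-free form). -/
theorem cruxWithoutDegree_iff' (hB : TwoCbrtTwoFields) :
    PureCubicClassGroupFBQPWithoutDegree ↔ ¬ DegreeOnePrimesEscape :=
  ⟨fun h hE => not_conclusionWithoutDegree' hB (h hE), fun h hE => absurd hE h⟩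

/-! ## Cycle 2: how much of the hypothesis is consumed

`DegreeOnePrimesEscape` quantifies over every degree `n`; the line consumes its `n = 3` slice only
(the landed `Theorems.LinnikCubicClassGroups.stub_generation` opens with `obtain ⟨C₃, hC₃⟩ := hEsc 3`),
and at `n = 3` the no-quadratic-subfield clause is AUTOMATIC (tower law).  So the skeleton proves
the formally STRONGER statement `CubicEscape → Conclusion`; the `∀ n` is unnecessary strength of
the crux's hypothesis (information for the planner: the conditional theorem earned by the line is
"escape at n = 3 ⟹ h(ℚ(∛m)) ∈ FBQP"). -/

/-- The degree-`n` slice of the route's hypothesis `DegreeOnePrimesEscape`. -/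
def DegreeOnePrimesEscapeAt (n : ℕ) : Prop :=
  ∃ C : ℕ, ∀ (K : Type) [Field K] [NumberField K], Module.finrank ℚ K = n →
    (∀ F : IntermediateField ℚ K, Module.finrank ℚ F ≠ 2) → ∀ x : ℕ,
    |NumberField.discr K| ^ C ≤ (x : ℤ) →
    ∀ M : Subgroup (ClassGroup (NumberField.RingOfIntegers K)), M ≠ ⊤ →
      Nat.primeCounting x ≤ 8 * Set.ncard {P : Ideal (NumberField.RingOfIntegers K) |
        P.IsPrime ∧ (Ideal.absNorm P).Prime ∧ Ideal.absNorm P ≤ x ∧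
        ∃ hP : P ∈ nonZeroDivisors (Ideal (NumberField.RingOfIntegers K)), ClassGroup.mk0 ⟨P, hP⟩ ∉ M}

/-- The escape count for CUBIC fields, with no subfield clause at all. -/
def CubicEscape : Prop :=
  ∃ C : ℕ, ∀ (K : Type) [Field K] [NumberField K], Module.finrank ℚ K = 3 → ∀ x : ℕ,
    |NumberField.discr K| ^ C ≤ (x : ℤ) →
    ∀ M : Subgroup (ClassGroup (NumberField.RingOfIntegers K)), M ≠ ⊤ →
      Nat.primeCounting x ≤ 8 * Set.ncard {P : Ideal (NumberField.RingOfIntegers K) |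
        P.IsPrime ∧ (Ideal.absNorm P).Prime ∧ Ideal.absNorm P ≤ x ∧
        ∃ hP : P ∈ nonZeroDivisors (Ideal (NumberField.RingOfIntegers K)), ClassGroup.mk0 ⟨P, hP⟩ ∉ M}

/-- The hypothesis is literally the conjunction of its slices. -/
theorem degreeOnePrimesEscape_iff_forall :
    DegreeOnePrimesEscape ↔ ∀ n, DegreeOnePrimesEscapeAt n := Iff.rfl

/-- A cubic field has no quadratic subfield (tower law). -/
theorem cubic_no_quadratic_subfield (K : Type) [Field K] [NumberField K]
    (hdeg : Module.finrank ℚ K = 3) (F : IntermediateField ℚ K) : Module.finrank ℚ F ≠ 2 := by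
  intro h2
  have h := Module.finrank_mul_finrank ℚ F K
  rw [hdeg, h2] at h
  omega

/-- At `n = 3` the subfield clause is vacuous-automatically: the slice IS `CubicEscape`. -/
theorem cubicEscape_iff : CubicEscape ↔ DegreeOnePrimesEscapeAt 3 := by
  constructor
  · rintro ⟨C, hC⟩
    exact ⟨C, fun K _ _ hdeg _ x hx M hM => hC K hdeg x hx M hM⟩
  · rintro ⟨C, hC⟩
    exact ⟨C, fun K _ _ hdeg x hx M hM => hC K hdeg (cubic_no_quadratic_subfield K hdeg) x hx M hM⟩

/-- The route's hypothesis gives the cubic escape count. -/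
theorem cubicEscape_of_escape (h : DegreeOnePrimesEscape) : CubicEscape :=
  cubicEscape_iff.mpr (h 3)

/-- The crux with its hypothesis WEAKENED to the slice actually consumed. -/
def PureCubicClassGroupFBQPOfCubicEscape : Prop := CubicEscape → Conclusion

/-- Weakening the hypothesis to `CubicEscape` yields a STRONGER statement that still implies the
crux; this is what the skeleton `arakelov-giant-step-cycle` really proves. -/
theorem crux_of_cruxOfCubicEscape (h : PureCubicClassGroupFBQPOfCubicEscape) :
    PureCubicClassGroupFBQP :=
  fun hE => h (cubicEscape_of_escape hE)

/-- … and a refutation of the crux refutes the cubic-escape form as well. -/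
theorem not_cruxOfCubicEscape_of_not_crux (h : ¬ PureCubicClassGroupFBQP) :
    ¬ PureCubicClassGroupFBQPOfCubicEscape :=
  fun h' => h (crux_of_cruxOfCubicEscape h')

/-- Degenerate slices of the hypothesis hold trivially: `n = 2` (the subfield clause fails at
`F = ⊤`), so the quadratic case the card originally aimed at is EXCLUDED, as the route says. -/
theorem degreeOnePrimesEscapeAt_two : DegreeOnePrimesEscapeAt 2 := by
  refine ⟨0, fun K _ _ hdeg hF x _ M _ => ?_⟩
  exact absurd (by rw [IntermediateField.finrank_top', hdeg]) (hF ⊤)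

/-- `n = 1`: then `K ≅ ℚ`, `h = 1`, and no proper subgroup `M ≠ ⊤` of the class group exists. -/
theorem degreeOnePrimesEscapeAt_one : DegreeOnePrimesEscapeAt 1 := by
  refine ⟨0, fun K _ _ hdeg _ x _ M hM => ?_⟩
  exfalso
  apply hM
  have hbij := (Algebra.finrank_eq_one_iff_bijective_algebraMap (F := ℚ) (E := K)).mp hdeg
  have h1 : NumberField.classNumber K = 1 := by
    rw [← classNumber_eq_of_ringEquiv (RingEquiv.ofBijective (algebraMap ℚ K) hbij)]
    exact Rat.classNumber_eq
  haveI : Subsingleton (ClassGroup (NumberField.RingOfIntegers K)) :=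
    Fintype.card_le_one_iff_subsingleton.mp (le_of_eq h1)
  exact eq_top_iff.mpr fun g _ => by rw [Subsingleton.elim g 1]; exact M.one_mem

/-- `n = 0`: no number field has degree `0`. -/
theorem degreeOnePrimesEscapeAt_zero : DegreeOnePrimesEscapeAt 0 :=
  ⟨0, fun _ _ _ hdeg => absurd hdeg Module.finrank_pos.ne'⟩


/-! ## Cycle 2: the arithmetic inputs DISCHARGED — `h(ℚ(∛2)) = 1`, `h(ℚ(∛7)) ≠ 1`, unconditionally

The modulus-free input `TwoCubicClassNumbers` is now a THEOREM of this file (`twoCubicClassNumbers`):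

* `classNumber_eq_one_of_cbrt_two` — EVERY cubic number field containing a cube root of `2` has
  class number `1`: the Minkowski bound is `< 3` (`|d_K| ≤ 27·2² = 108` by the landed
  `Theorems.LinnikCubicClassGroups.factsDiscr`, `π > 3.14`), and a prime of norm `2` contains
  `2 = α³`, hence `α`, while `(α)` has norm `|N(α)| = 2` — so it IS `(α)`;
* `classNumber_ne_one_of_cbrt_seven` — EVERY cubic number field containing a cube root of `7` has
  class number `≠ 1`: `ℤ[α]` is `7`-maximal (`disc(1,α,α²) = −27·7²` and Eisenstein at `7`:
  `−27·𝓞_K ⊆ ℤ[α]`, `smul_mem_adjoin_cbrt_seven`), the NORM FORM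
  `N(a + bα + cα²) = a³ + m b³ + m² c³ − 3m·abc` (`norm_form`, any non-cube `m`) makes every norm
  of an algebraic integer a CUBE mod `7` (`norm_modEq_cube`), so no integer of `K` has norm `±2`
  (`natAbs_norm_ne_two`), yet a prime ideal of norm `2` exists (`N(α − 1) = 6`, prime-ideal norms
  are prime powers: `exists_isPrime_absNorm_eq_two`) and cannot be principal.

Consequences (sorry-free, standard axioms): the non-cube guard and the cube-root clause are
load-bearing UNCONDITIONALLY (`not_conclusionWithoutNonCube_holds`,
`not_conclusionWithoutCubeRoot_holds`; the mutilated cruxes are literally `¬ DegreeOnePrimesEscape`: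
`cruxWithoutNonCube_iff_not_escape`, `cruxWithoutCubeRoot_iff_not_escape`), and the value clause
has a concrete UNIT TEST any prover's construction must pass: at `x = [false]` (`m = 2`) the
demanded word is `h = 1` in ten bits (`valueClause_at_false`, `canonicalF_false`). -/

section classNumbers

open scoped NumberField nonZeroDivisors
open Polynomial NumberField
open Summit.QuantumAdvantage.QuantumAdvantage.Theorems.LinnikCubicClassGroups
  (facts_irreducible factsDiscr facts_discr_powers factsExists)

variable {K : Type*} [Field K] [NumberField K]



/-- The norm of a cube root `α` of a non-cube `m` generating a cubic field is `m`
(`N(α) = (-1)^3 · (X³ - m)(0)`). -/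
theorem norm_cbrt (hdeg : Module.finrank ℚ K = 3) {m : ℕ} (hm : ∀ r : ℕ, r ^ 3 ≠ m)
    {α : K} (hα : α ^ 3 = (m : K)) : Algebra.norm ℚ α = m := by
  have hint : IsIntegral ℚ α := Algebra.IsIntegral.isIntegral α
  have hmin : minpoly ℚ α = X ^ 3 - C (m : ℚ) :=
    (minpoly.eq_of_irreducible_of_monic (facts_irreducible m hm) (by simp [hα])
      (monic_X_pow_sub_C _ three_ne_zero)).symm
  have hnat : (minpoly ℚ α).natDegree = 3 := by rw [hmin, natDegree_X_pow_sub_C]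
  have htop : Algebra.adjoin ℚ {α} = ⊤ :=
    (IntermediateField.adjoin_eq_top_iff_of_isAlgebraic
      fun x _ => Algebra.IsAlgebraic.isAlgebraic x).mp
      ((Field.primitive_element_iff_minpoly_natDegree_eq ℚ α).mpr (hnat.trans hdeg.symm))
  have := Algebra.PowerBasis.norm_gen_eq_coeff_zero_minpoly (PowerBasis.ofAdjoinEqTop hint htop)
  rw [PowerBasis.ofAdjoinEqTop_gen, PowerBasis.ofAdjoinEqTop_dim, hnat, hmin] at this
  rw [this, coeff_sub, coeff_X_pow, coeff_C_zero]
  norm_num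

omit [NumberField K] in
/-- A cube root of a natural number is an algebraic integer. -/
theorem isIntegral_cbrt {m : ℕ} {α : K} (hα : α ^ 3 = (m : K)) : IsIntegral ℤ α :=
  ⟨X ^ 3 - C (m : ℤ), monic_X_pow_sub_C _ three_ne_zero, by simp [hα]⟩

open NumberField.InfinitePlace Module Real in
/-- The Minkowski bound of a cubic field containing `∛2` is `< 3`:
`M_K ≤ (4/π)·(6/27)·√108 ≈ 2.94` (using `|d_K| ≤ 27·2² = 108` from the landed `factsDiscr`). -/
theorem minkowskiBound_lt_three (hdeg : Module.finrank ℚ K = 3) {α : K}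
    (hα : α ^ 3 = ((2 : ℕ) : K)) :
    (4 / π) ^ nrComplexPlaces K *
        ((Nat.factorial (finrank ℚ K) : ℝ) / (finrank ℚ K : ℝ) ^ finrank ℚ K *
          √|(discr K : ℝ)|) < 3 := by
  have hr2 : nrComplexPlaces K ≤ 1 := by
    have := card_add_two_mul_card_eq_rank K; omega
  have hpi : (3.14 : ℝ) < π := Real.pi_gt_d2
  have h1 : (4 / π : ℝ) ^ nrComplexPlaces K ≤ 4 / 3.14 := by
    have h4 : (4 / π : ℝ) ≤ 4 / 3.14 :=
      div_le_div_of_nonneg_left (by norm_num) (by norm_num) hpi.le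
    rcases Nat.le_one_iff_eq_zero_or_eq_one.mp hr2 with h | h <;> rw [h]
    · rw [pow_zero]
      exact le_trans (by rw [le_div_iff₀ Real.pi_pos]; linarith [Real.pi_le_four]) h4
    · rwa [pow_one]
  have h2 : ((Nat.factorial (finrank ℚ K) : ℝ) / (finrank ℚ K : ℝ) ^ finrank ℚ K) = 2 / 9 := by
    rw [hdeg]; norm_num [Nat.factorial]
  have h3 : √|(discr K : ℝ)| < 10.4 := by
    rw [Real.sqrt_lt' (by norm_num)]
    have h := factsDiscr hdeg two_not_cube hα
    have h' : ((|discr K| : ℤ) : ℝ) ≤ 27 * (2 : ℝ) ^ 2 := by exact_mod_cast h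
    rw [Int.cast_abs] at h'
    linarith
  have h0 : (0 : ℝ) ≤ √|(discr K : ℝ)| := Real.sqrt_nonneg _
  have h0' : (0 : ℝ) ≤ (4 / π : ℝ) ^ nrComplexPlaces K := by positivity
  calc (4 / π) ^ nrComplexPlaces K * ((Nat.factorial (finrank ℚ K) : ℝ) /
          (finrank ℚ K : ℝ) ^ finrank ℚ K * √|(discr K : ℝ)|)
      = (4 / π) ^ nrComplexPlaces K * (2 / 9 * √|(discr K : ℝ)|) := by rw [h2]
    _ ≤ (4 / 3.14) * (2 / 9 * √|(discr K : ℝ)|) := by gcongr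
    _ < (4 / 3.14) * (2 / 9 * 10.4) := by gcongr
    _ < 3 := by norm_num

/-- **`h(K) = 1` for every cubic number field `K` containing a cube root of `2`** (e.g. `ℚ(∛2)`;
Dedekind 1900 / Cohen GTM 138 Table B.3, `d = −108`).  Proof: by Minkowski every ideal class
contains a prime `P` of norm `≤ M_K < 3`; a prime of norm `2` contains `2 = α³`, hence `α`, and
`(α)` has norm `|N(α)| = 2`, so `P = (α)` is principal. -/
theorem classNumber_eq_one_of_cbrt_two (hdeg : Module.finrank ℚ K = 3) {α : K}
    (hα : α ^ 3 = 2) : classNumber K = 1 := by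
  have hα' : α ^ 3 = ((2 : ℕ) : K) := by rw [hα]; norm_num
  rw [classNumber_eq_one_iff]
  refine RingOfIntegers.isPrincipalIdealRing_of_isPrincipal_of_norm_le_of_isPrime
    fun I hI hle => ?_
  -- the norm of `I` is `2`
  have hlt : (Ideal.absNorm (I : Ideal (𝓞 K)) : ℝ) < 3 :=
    lt_of_le_of_lt hle (minkowskiBound_lt_three hdeg hα')
  have hN3 : Ideal.absNorm (I : Ideal (𝓞 K)) < 3 := by exact_mod_cast hlt
  have hN0 : Ideal.absNorm (I : Ideal (𝓞 K)) ≠ 0 := Ideal.absNorm_ne_zero_of_nonZeroDivisors I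
  have hN1 : Ideal.absNorm (I : Ideal (𝓞 K)) ≠ 1 := by
    rw [Ne, Ideal.absNorm_eq_one_iff]; exact hI.ne_top
  have hN2 : Ideal.absNorm (I : Ideal (𝓞 K)) = 2 := by omega
  -- `α ∈ I`
  let a : 𝓞 K := ⟨α, (mem_integralClosure_iff ℤ K).mpr (isIntegral_cbrt hα')⟩
  have ha3 : a ^ 3 = 2 := RingOfIntegers.ext (by push_cast; exact hα)
  have h2mem : (2 : 𝓞 K) ∈ (I : Ideal (𝓞 K)) := by
    have := Ideal.absNorm_mem (I : Ideal (𝓞 K))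
    rw [hN2] at this
    exact_mod_cast this
  have hamem : a ∈ (I : Ideal (𝓞 K)) := hI.mem_of_pow_mem 3 (by rw [ha3]; exact h2mem)
  have hle' : Ideal.span {a} ≤ (I : Ideal (𝓞 K)) := (Ideal.span_singleton_le_iff_mem _).mpr hamem
  -- `(α)` has norm `2`
  have hNa : Ideal.absNorm (Ideal.span {a}) = 2 := by
    rw [Ideal.absNorm_span_singleton]
    have hq : (Algebra.norm ℤ a : ℚ) = 2 := by
      rw [Algebra.coe_norm_int, show ((a : 𝓞 K) : K) = α from rfl]
      have := norm_cbrt hdeg two_not_cube hα'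
      simpa using this
    have hz : Algebra.norm ℤ a = 2 := by exact_mod_cast hq
    rw [hz]; rfl
  -- hence `I = (α)`
  obtain ⟨J, hJ⟩ := Ideal.dvd_iff_le.mpr hle'
  have hJ1 : Ideal.absNorm J = 1 := by
    have h := congr_arg Ideal.absNorm hJ
    rw [map_mul, hNa, hN2] at h
    omega
  rw [Ideal.absNorm_eq_one_iff] at hJ1
  rw [hJ1, Ideal.mul_top] at hJ
  exact ⟨⟨a, hJ.symm⟩⟩




/-! ### Generalities -/

/-- In a Dedekind domain with finite quotients: if a rational prime `q` divides the norm of a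
nonzero ideal `I`, some prime ideal `P ⊇ I` has norm divisible by `q`. -/
theorem exists_prime_le_of_dvd_absNorm {S : Type*} [CommRing S] [IsDedekindDomain S]
    [Module.Free ℤ S] [Module.Finite ℤ S] {q : ℕ} (hq : q.Prime) (I : Ideal S) :
    I ≠ ⊥ → q ∣ Ideal.absNorm I →
      ∃ P : Ideal S, P.IsPrime ∧ P ≠ ⊥ ∧ I ≤ P ∧ q ∣ Ideal.absNorm P := by
  induction I using UniqueFactorizationMonoid.induction_on_prime with
  | h₁ => intro h; exact absurd rfl h
  | h₂ I hI =>
    intro _ hdvd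
    rw [Ideal.isUnit_iff.mp hI, ← Ideal.one_eq_top, map_one] at hdvd
    exact absurd (Nat.le_of_dvd one_pos hdvd) (by have := hq.two_le; omega)
  | h₃ I P hI0 hP ih =>
    intro _ hdvd
    rw [map_mul] at hdvd
    rcases hq.dvd_mul.mp hdvd with h | h
    · exact ⟨P, Ideal.isPrime_of_prime hP, hP.ne_zero, Ideal.mul_le_right, h⟩
    · obtain ⟨Q, hQ, hQ0, hle, hQd⟩ := ih hI0 h
      exact ⟨Q, hQ, hQ0, le_trans Ideal.mul_le_left hle, hQd⟩

/-- The norm of a nonzero prime ideal of a ring of integers is a prime power (the quotient is a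
finite field). -/
theorem isPrimePow_absNorm_of_isPrime {S : Type*} [CommRing S] [IsDedekindDomain S]
    [Module.Free ℤ S] [Module.Finite ℤ S] {P : Ideal S} (hP : P.IsPrime) (hP0 : P ≠ ⊥) :
    IsPrimePow (Ideal.absNorm P) := by
  haveI : P.IsMaximal := hP.isMaximal hP0
  letI : Field (S ⧸ P) := Ideal.Quotient.field P
  haveI : Finite (S ⧸ P) := Ideal.finiteQuotientOfFreeOfNeBot P hP0
  letI : Fintype (S ⧸ P) := Fintype.ofFinite _
  rw [Ideal.absNorm_apply, Submodule.cardQuot_apply, Nat.card_eq_fintype_card]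
  exact FiniteField.isPrimePow_card (S ⧸ P)

/-- `6` is not a prime power. -/
theorem not_isPrimePow_six : ¬ IsPrimePow 6 := by
  rw [isPrimePow_nat_iff]
  rintro ⟨p, k, hp, hk, hpk⟩
  have hp6 : p ∣ 6 := ⟨p ^ (k - 1), by rw [← pow_succ', Nat.sub_add_cancel hk, hpk]⟩
  have h23 : p = 2 ∨ p = 3 := by
    rcases (Nat.Prime.dvd_mul hp).mp (show p ∣ 2 * 3 from hp6) with h | h
    · exact Or.inl ((Nat.prime_dvd_prime_iff_eq hp Nat.prime_two).mp h)
    · exact Or.inr ((Nat.prime_dvd_prime_iff_eq hp Nat.prime_three).mp h)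
  rcases h23 with rfl | rfl
  · have : 3 ∣ 2 ^ k := ⟨2, by omega⟩
    exact absurd (Nat.Prime.dvd_of_dvd_pow Nat.prime_three this) (by norm_num)
  · have : 2 ∣ 3 ^ k := ⟨3, by omega⟩
    exact absurd (Nat.Prime.dvd_of_dvd_pow Nat.prime_two this) (by norm_num)

/-- `7` is not a cube. -/
theorem seven_not_cube : ∀ r : ℕ, r ^ 3 ≠ 7 := by
  intro r
  rcases Nat.lt_or_ge r 2 with hr | hr
  · interval_cases r <;> decide
  · have : 2 ^ 3 ≤ r ^ 3 := Nat.pow_le_pow_left hr 3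
    omega

/-- `X³ − 7` is Eisenstein at `7`. -/
theorem isEisensteinAt_X_pow_three_sub_seven :
    (X ^ 3 - C (7 : ℤ) : ℤ[X]).IsEisensteinAt (Submodule.span ℤ {(7 : ℤ)}) := by
  have hmonic : (X ^ 3 - C (7 : ℤ) : ℤ[X]).Monic := monic_X_pow_sub_C _ three_ne_zero
  refine ⟨?_, ?_, ?_⟩
  · rw [hmonic.leadingCoeff]
    change (1 : ℤ) ∉ Ideal.span {(7 : ℤ)}
    rw [Ideal.mem_span_singleton]; norm_num
  · intro n hn
    rw [natDegree_X_pow_sub_C] at hn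
    change (X ^ 3 - C (7 : ℤ) : ℤ[X]).coeff n ∈ Ideal.span {(7 : ℤ)}
    rw [Ideal.mem_span_singleton, coeff_sub, coeff_X_pow, coeff_C]
    interval_cases n <;> simp
  · change (X ^ 3 - C (7 : ℤ) : ℤ[X]).coeff 0 ∉ Ideal.span {(7 : ℤ)} ^ 2
    rw [Ideal.span_singleton_pow, Ideal.mem_span_singleton, coeff_sub, coeff_X_pow, coeff_C]
    norm_num


/-- The minimal polynomial over `ℚ` of a cube root of a non-cube `m`. -/
theorem minpoly_rat_cbrt {m : ℕ} (hm : ∀ r : ℕ, r ^ 3 ≠ m) {α : K} (hα : α ^ 3 = (m : K)) :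
    minpoly ℚ α = X ^ 3 - C (m : ℚ) :=
  (minpoly.eq_of_irreducible_of_monic (facts_irreducible m hm) (by simp [hα])
    (monic_X_pow_sub_C _ three_ne_zero)).symm

/-- The minimal polynomial over `ℤ` of a cube root of a non-cube `m`. -/
theorem minpoly_int_cbrt {m : ℕ} (hm : ∀ r : ℕ, r ^ 3 ≠ m) {α : K} (hα : α ^ 3 = (m : K)) :
    minpoly ℤ α = X ^ 3 - C (m : ℤ) := by
  have hint : IsIntegral ℤ α := isIntegral_cbrt hα
  have h₁ := minpoly.isIntegrallyClosed_eq_field_fractions' ℚ hint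
  apply Polynomial.map_injective (algebraMap ℤ ℚ) (algebraMap ℤ ℚ).injective_int
  rw [← h₁, minpoly_rat_cbrt hm hα]
  simp

/-! ### The norm form of `ℚ(∛m)` in the basis `1, α, α²` -/

/-- **Norm form**: `N(a + bα + cα²) = a³ + m b³ + m² c³ − 3m·abc` for a cube root `α` of the
non-cube `m` in a cubic field (determinant of the multiplication matrix
`[[a, mc, mb], [b, a, mc], [c, b, a]]`). -/
theorem norm_form (hdeg : Module.finrank ℚ K = 3) {m : ℕ} (hm : ∀ r : ℕ, r ^ 3 ≠ m)
    {α : K} (hα : α ^ 3 = (m : K)) (a b c : ℚ) :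
    Algebra.norm ℚ ((a : K) + (b : K) * α + (c : K) * α ^ 2)
      = a ^ 3 + m * b ^ 3 + m ^ 2 * c ^ 3 - 3 * m * a * b * c := by
  classical
  obtain ⟨pb, hgen, hdim, -⟩ := facts_discr_powers hdeg hm hα
  let e : Fin pb.dim ≃ Fin 3 := finCongr hdim
  let bs : Module.Basis (Fin 3) ℚ K := pb.basis.reindex e
  have hbs : ∀ i : Fin 3, bs i = α ^ (i : ℕ) := by
    intro i
    simp [bs, e, Module.Basis.reindex_apply, PowerBasis.coe_basis, hgen]
  let M : Matrix (Fin 3) (Fin 3) ℚ := !![a, m * c, m * b; b, a, m * c; c, b, a]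
  have hM : Algebra.leftMulMatrix bs ((a : K) + (b : K) * α + (c : K) * α ^ 2) = M := by
    rw [Algebra.leftMulMatrix_apply]
    apply (LinearMap.toMatrix bs bs).symm.injective
    rw [LinearMap.toMatrix_symm, Matrix.toLin_toMatrix]
    refine bs.ext fun j => ?_
    rw [Matrix.toLin_self, Algebra.coe_lmul_eq_mul, LinearMap.mul_apply']
    fin_cases j
    · simp [hbs, Fin.sum_univ_three, M, Algebra.smul_def, eq_ratCast]
    · simp [hbs, Fin.sum_univ_three, M, Algebra.smul_def, eq_ratCast]
      linear_combination (c : K) * hα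
    · simp [hbs, Fin.sum_univ_three, M, Algebra.smul_def, eq_ratCast]
      linear_combination ((b : K) + (c : K) * α) * hα
  rw [Algebra.norm_eq_matrix_det bs, hM, Matrix.det_fin_three]
  simp [M]
  ring

/-! ### `ℤ[∛7]` is `7`-maximal: `-27 · 𝓞_K ⊆ ℤ[α]` -/

omit [NumberField K] in
/-- Elements of `ℤ[α]` (`α³ = m`) have integer coordinates in `1, α, α²`. -/
theorem exists_int_coords {m : ℕ} {α : K} (hα : α ^ 3 = (m : K)) {w : K}
    (hw : w ∈ Algebra.adjoin ℤ ({α} : Set K)) : ∃ a b c : ℤ, w = a + b * α + c * α ^ 2 := by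
  rw [Algebra.adjoin_singleton_eq_range_aeval] at hw
  obtain ⟨q, rfl⟩ := hw
  set p : ℤ[X] := X ^ 3 - C (m : ℤ) with hp
  have hmonic : p.Monic := monic_X_pow_sub_C _ three_ne_zero
  have hroot : aeval α p = 0 := by simp [hp, hα]
  have hmod : aeval α (q %ₘ p) = aeval α q := by
    rw [Polynomial.modByMonic_eq_sub_mul_div q p, map_sub, map_mul, hroot, zero_mul, sub_zero]
  have hp1 : p ≠ 1 := by
    intro h
    have := congr_arg natDegree h
    rw [hp, natDegree_X_pow_sub_C, natDegree_one] at this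
    exact absurd this (by norm_num)
  have hdeg3 : (q %ₘ p).natDegree < 3 := by
    have := Polynomial.natDegree_modByMonic_lt q hmonic hp1
    rwa [hp, natDegree_X_pow_sub_C] at this
  refine ⟨(q %ₘ p).coeff 0, (q %ₘ p).coeff 1, (q %ₘ p).coeff 2, ?_⟩
  change (aeval α) q = _
  rw [← hmod, Polynomial.aeval_eq_sum_range' hdeg3]
  simp [Finset.sum_range_succ, Algebra.smul_def]

/-- **`7`-maximality of `ℤ[∛7]`** (Eisenstein at `7`): for every algebraic integer `z` of a cubic
field `K ∋ α`, `α³ = 7`, one has `-27 z ∈ ℤ[α]` (`disc(1, α, α²) = -27·7²` multiplies `z` into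
`ℤ[α]`, and the Eisenstein criterion at `7` removes the factor `7²`). -/
theorem smul_mem_adjoin_cbrt_seven (hdeg : Module.finrank ℚ K = 3) {α : K}
    (hα : α ^ 3 = ((7 : ℕ) : K)) {z : K} (hz : IsIntegral ℤ z) :
    (-27 : ℤ) • z ∈ Algebra.adjoin ℤ ({α} : Set K) := by
  obtain ⟨pb, hgen, -, hdiscr⟩ := facts_discr_powers hdeg seven_not_cube hα
  have hint : IsIntegral ℤ pb.gen := by rw [hgen]; exact isIntegral_cbrt hα
  have H := Algebra.discr_mul_isIntegral_mem_adjoin ℚ hint hz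
  rw [hdiscr] at H
  have hint27 : IsIntegral ℤ ((-27 : ℤ) • z) := hz.zsmul _
  have key : (7 : ℤ) ^ 2 • ((-27 : ℤ) • z) ∈ Algebra.adjoin ℤ ({pb.gen} : Set K) := by
    have e : (-27 * ((7 : ℕ) : ℚ) ^ 2) • z = (7 : ℤ) ^ 2 • ((-27 : ℤ) • z) := by
      rw [Algebra.smul_def, zsmul_eq_mul, zsmul_eq_mul, eq_ratCast]
      push_cast
      ring
    rw [← e]; exact H
  have hei : (minpoly ℤ pb.gen).IsEisensteinAt (Submodule.span ℤ {(7 : ℤ)}) := by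
    rw [hgen, minpoly_int_cbrt seven_not_cube hα, show ((7 : ℕ) : ℤ) = 7 from rfl]
    exact isEisensteinAt_X_pow_three_sub_seven
  have := mem_adjoin_of_smul_prime_pow_smul_of_minpoly_isEisensteinAt (R := ℤ) (K := ℚ)
    (Int.prime_iff_natAbs_prime.mpr (by norm_num)) hint hint27 key hei
  rwa [hgen] at this

/-- **Norms of algebraic integers of `K ∋ ∛7` are cubes modulo `7`**: `-27 z = a + bα + cα²`
with `a, b, c ∈ ℤ`, and `(-27)³ N(z) = a³ + 7b³ + 49c³ − 21abc ≡ a³ (mod 7)`, `(-27)³ ≡ 1`. -/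
theorem norm_modEq_cube (hdeg : Module.finrank ℚ K = 3) {α : K} (hα : α ^ 3 = ((7 : ℕ) : K))
    (z : 𝓞 K) : ∃ a : ℤ, Algebra.norm ℤ z ≡ a ^ 3 [ZMOD 7] := by
  obtain ⟨a, b, c, habc⟩ :=
    exists_int_coords hα (smul_mem_adjoin_cbrt_seven hdeg hα (RingOfIntegers.isIntegral_coe z))
  refine ⟨a, ?_⟩
  have habc' : (-27 : ℤ) • (z : K) = a + b * α + c * α ^ 2 := habc
  have h27 : Algebra.norm ℚ ((-27 : ℤ) • (z : K)) = (-27) ^ 3 * Algebra.norm ℚ (z : K) := by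
    rw [← Int.cast_smul_eq_zsmul ℚ, Algebra.smul_def, map_mul, Algebra.norm_algebraMap, hdeg]
    norm_num
  have hf := norm_form hdeg seven_not_cube hα a b c
  push_cast at hf
  rw [← habc', h27] at hf
  have hq : (((-27 : ℤ) ^ 3 * Algebra.norm ℤ z : ℤ) : ℚ)
      = ((a ^ 3 + 7 * b ^ 3 + 7 ^ 2 * c ^ 3 - 3 * 7 * a * b * c : ℤ) : ℚ) := by
    push_cast
    rw [Algebra.coe_norm_int]
    linarith [hf]
  have hz : (-27 : ℤ) ^ 3 * Algebra.norm ℤ z = a ^ 3 + 7 * b ^ 3 + 7 ^ 2 * c ^ 3 - 3 * 7 * a * b * c := by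
    exact_mod_cast hq
  have h1 : (-27 : ℤ) ^ 3 * Algebra.norm ℤ z ≡ 1 * Algebra.norm ℤ z [ZMOD 7] :=
    Int.ModEq.mul_right _ (by decide)
  rw [one_mul] at h1
  refine h1.symm.trans ?_
  rw [hz]
  exact Int.modEq_iff_dvd.mpr ⟨-(b ^ 3 + 7 * c ^ 3 - 3 * a * b * c), by ring⟩

/-- Hence **no algebraic integer of `K ∋ ∛7` has norm `±2`** (`±2` are not cubes mod `7`). -/
theorem natAbs_norm_ne_two (hdeg : Module.finrank ℚ K = 3) {α : K} (hα : α ^ 3 = ((7 : ℕ) : K))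
    (z : 𝓞 K) : (Algebra.norm ℤ z).natAbs ≠ 2 := by
  obtain ⟨a, ha⟩ := norm_modEq_cube hdeg hα z
  have key : ∀ x : ZMod 7, x ^ 3 ≠ 2 ∧ x ^ 3 ≠ -2 := by decide
  have hc := (ZMod.intCast_eq_intCast_iff _ _ 7).mpr ha
  push_cast at hc
  intro h2
  rcases Int.natAbs_eq_iff.mp h2 with h | h
  · rw [h] at hc; push_cast at hc; exact (key _).1 hc.symm
  · rw [h] at hc; push_cast at hc; exact (key _).2 hc.symm

/-- **A prime ideal of norm `2` exists in `K ∋ ∛7`**: `N(α − 1) = 6`, so some prime `P ∋ α − 1`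
has even norm dividing `6`, and prime-ideal norms are prime powers. -/
theorem exists_isPrime_absNorm_eq_two (hdeg : Module.finrank ℚ K = 3) {α : K}
    (hα : α ^ 3 = ((7 : ℕ) : K)) : ∃ P : Ideal (𝓞 K), P.IsPrime ∧ Ideal.absNorm P = 2 := by
  let u : 𝓞 K := ⟨α, (mem_integralClosure_iff ℤ K).mpr (isIntegral_cbrt hα)⟩
  have hN6 : Algebra.norm ℤ (u - 1) = 6 := by
    have hq : (Algebra.norm ℤ (u - 1) : ℚ) = 6 := by
      rw [Algebra.coe_norm_int]
      have hf := norm_form hdeg seven_not_cube hα (-1) 1 0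
      have e : ((u - 1 : 𝓞 K) : K) = ((-1 : ℚ) : K) + ((1 : ℚ) : K) * α + ((0 : ℚ) : K) * α ^ 2 := by
        push_cast
        show α - 1 = _
        ring
      rw [e, hf]
      norm_num
    exact_mod_cast hq
  have hI6 : Ideal.absNorm (Ideal.span {u - 1}) = 6 := by
    rw [Ideal.absNorm_span_singleton, hN6]; rfl
  have hI0 : Ideal.span {u - 1} ≠ ⊥ := by
    intro h; rw [h, Ideal.absNorm_bot] at hI6; exact absurd hI6 (by norm_num)
  obtain ⟨P, hP, hP0, hle, h2⟩ :=
    exists_prime_le_of_dvd_absNorm Nat.prime_two _ hI0 (by rw [hI6]; norm_num)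
  refine ⟨P, hP, ?_⟩
  have h6 : Ideal.absNorm P ∣ 6 := hI6 ▸ Ideal.absNorm_dvd_absNorm_of_le hle
  have hpp := isPrimePow_absNorm_of_isPrime hP hP0
  obtain ⟨n, hn⟩ : ∃ n, Ideal.absNorm P = n := ⟨_, rfl⟩
  rw [hn] at h2 h6 hpp ⊢
  have hn6 : n ≤ 6 := Nat.le_of_dvd (by norm_num) h6
  interval_cases n
  · exact absurd hpp not_isPrimePow_zero
  · omega
  · rfl
  · omega
  · omega
  · omega
  · exact absurd hpp not_isPrimePow_six

/-- **`h(K) ≠ 1` for every cubic number field `K` containing a cube root of `7`** (e.g. `ℚ(∛7)`,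
where in print `h = 3`): a prime of norm `2` exists and cannot be principal, since no algebraic
integer has norm `±2`. -/
theorem classNumber_ne_one_of_cbrt_seven (hdeg : Module.finrank ℚ K = 3) {α : K}
    (hα : α ^ 3 = 7) : classNumber K ≠ 1 := by
  have hα' : α ^ 3 = ((7 : ℕ) : K) := by rw [hα]; norm_num
  intro h1
  rw [classNumber_eq_one_iff] at h1
  obtain ⟨P, hP, hN⟩ := exists_isPrime_absNorm_eq_two hdeg hα'
  obtain ⟨π, hπ⟩ := (IsPrincipalIdealRing.principal P).principal
  rw [hπ] at hN
  change Ideal.absNorm (Ideal.span {π}) = 2 at hN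
  rw [Ideal.absNorm_span_singleton] at hN
  exact natAbs_norm_ne_two hdeg hα' π hN


end classNumbers

open Summit.QuantumAdvantage.QuantumAdvantage.Theorems.LinnikCubicClassGroups (factsExists) in
/-- **`TwoCubicClassNumbers` holds**: `ℚ[X]/(X³ − 2)` has `h = 1` and `ℚ[X]/(X³ − 7)` has `h ≠ 1`. -/
theorem twoCubicClassNumbers : TwoCubicClassNumbers := by
  obtain ⟨K₁, i₁, i₂, h1, α₁, hα₁⟩ := factsExists 2 two_not_cube
  obtain ⟨K₂, i₃, i₄, h2, α₂, hα₂⟩ := factsExists 7 seven_not_cube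
  refine ⟨K₁, i₁, i₂, K₂, i₃, i₄, h1, h2, ?_⟩
  rw [classNumber_eq_one_of_cbrt_two h1 (by rw [hα₁]; norm_num)]
  exact (classNumber_ne_one_of_cbrt_seven h2 (by rw [hα₂]; norm_num)).symm

/-- **UNCONDITIONAL: any proof must use the non-cube guard** — with it deleted, the conclusion of
the crux is false outright. -/
theorem not_conclusionWithoutNonCube_holds : ¬ ConclusionWithoutNonCube :=
  not_conclusionWithoutNonCube' twoCubicClassNumbers

/-- **UNCONDITIONAL**: the crux with the non-cube guard deleted is literally `¬ DegreeOnePrimesEscape`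
(it would refute the route's own crux #2). -/
theorem cruxWithoutNonCube_iff_not_escape :
    PureCubicClassGroupFBQPWithoutNonCube ↔ ¬ DegreeOnePrimesEscape :=
  cruxWithoutNonCube_iff' twoCubicClassNumbers

/-- **UNCONDITIONAL: any proof must use the cube-root clause.** -/
theorem not_conclusionWithoutCubeRoot_holds : ¬ ConclusionWithoutCubeRoot :=
  not_conclusionWithoutCubeRoot' twoCubicClassNumbers

/-- **UNCONDITIONAL**: the crux with the cube-root clause deleted is `¬ DegreeOnePrimesEscape`. -/
theorem cruxWithoutCubeRoot_iff_not_escape :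
    PureCubicClassGroupFBQPWithoutCubeRoot ↔ ¬ DegreeOnePrimesEscape :=
  cruxWithoutCubeRoot_iff' twoCubicClassNumbers

open Summit.QuantumAdvantage.QuantumAdvantage.Theorems.LinnikCubicClassGroups (factsExists) in
/-- Admissible data exist exactly at the non-cube inputs (the forward direction is the landed
`factsExists`). -/
theorem nonempty_admissible_iff (x : List Bool) :
    Nonempty (Admissible x) ↔ ∀ r : ℕ, r ^ 3 ≠ decodeNat x := by
  constructor
  · rintro ⟨a⟩; exact a.noncube
  · intro hm
    obtain ⟨K, i₁, i₂, hK, α, hα⟩ := factsExists (decodeNat x) hm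
    exact ⟨@Admissible.mk x K i₁ i₂ hK hm α hα⟩

/-- **Unit test of the value clause at `x = [false]` (`m = 2`)**: every admissible `K` is a cubic
field `∋ ∛2`, so `h(K) = 1` and the demanded word is `1` in ten bits (little-endian). -/
theorem classNumberBits_false {K : Type} [Field K] [NumberField K] (hK : Module.finrank ℚ K = 3)
    {α : K} (hα : α ^ 3 = (decodeNat [false] : K)) :
    classNumberBits [false] K = true :: List.replicate 9 false := by
  have h1 : NumberField.classNumber K = 1 :=
    classNumber_eq_one_of_cbrt_two hK (by rw [hα, decodeNat_false]; norm_num)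
  simp only [classNumberBits, h1]
  decide

/-- Any `f` satisfying the value clause outputs `h(ℚ(∛2)) = 1` at `x = [false]`. -/
theorem valueClause_at_false {f : List Bool → List Bool} (hf : ValueClause f) :
    f [false] = true :: List.replicate 9 false := by
  obtain ⟨a⟩ := (nonempty_admissible_iff [false]).mpr decodeNat_false_not_cube
  rw [hf [false] a.K a.rank a.noncube ⟨a.α, a.root⟩]
  exact classNumberBits_false a.rank a.root

/-- The canonical candidate passes the unit test: `canonicalF [false]` is `1` in ten bits. -/
theorem canonicalF_false : canonicalF [false] = true :: List.replicate 9 false :=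
  valueClause_at_false canonicalF_value


end Summit.QuantumAdvantage.QuantumAdvantage.Cruxes.PureCubicClassGroupFBQP.Disproof

end
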